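import Literature.NumberTheory.Rogawski1990.DepthZeroTransferHValuesLeviPow         -- ★ (p07 (g12)): `stableOrbitalIntegralRel_chiZero_eq_mul_pow_of_levi` ∕ `…chiOne_eq_mul_pow_sub_of_levi`, `skewModulus_eq_inv_pow_of_valued_eq`; ⊇ ★ p846606 (δ)
import Literature.NumberTheory.Rogawski1990.UnitFundamentalLemmaInertLeviClause      -- ★ transport `isLocalGRegular_conj_iff`, `charpoly_map_endoEmbLocal_conj`; ⊇ ★ `UnitFundamentalLemmaInertLevi`
import Literature.NumberTheory.Rogawski1990.LocalDeltaTransferLeviStratum            -- ★ one-term sockets `finsum_delta_mul_classOrbitalIntegral_eq_of_unique`, `stableOrbitalIntegralRel_eq_classOrbitalIntegral_of_unique`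
import Literature.NumberTheory.Rogawski1990.FinExplicitTransferFactorStableInvariance -- ★ `finExplicitCollection_Δ_eq_of_isLocalStablyConjH`
import Literature.NumberTheory.Automorphic.TorusDeepOrbitalIntegralStrata            -- ★ p846544: deep torus membership; the (g2′) socket's `J₃` token
import HarnessLib

/-!
# The LEVI ROW of the depth-zero κ-transfer, as a SOCKET in the `G`-side orbital value (Rogawski (1990) §4.9 Prop. 4.9.1, §4.3 (4.3.1))

Topic `NumberTheory/Rogawski1990`; namespace `Literature.NumberTheory.Rogawski1990`.  KERNEL mathematics only: theorems, no definition, no named fact, no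
instance, no notation, no `sorry`.  Cell `pub/hodgecm-mathlib`, road «S3-tree», T3′ «DEPTH-ZERO κ-TRANSFER» population P-3 «LEVI»: organ **(O5-core)** (architect
A-149 (1); seat F0P3-p02 (g15), A-54 fallback for F0P3a-p01 (g15)).  CONSUMERS: L-γ `stub_T3prime_levi` (★ (O1) p846586 + ★ (O2) p846544 §3 + ★ p846176) and
(L) `stub_liftLevi` (p04's (O1″) + ★ (O2″) p846625 + A-105's `ring` identity).  HONEST LABEL: HC_CM is proved only modulo the 2 remaining named inputs (hLiu418 24832,
h413 24833) until rung 0 closes; this file discharges no named fact.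

THE MATHEMATICS.  At a finite place `v` of `L⁺` non-split and unramified in `L`, `H′` of good reduction at `w`, `μ` unramified under the N7 guard, canonical families
`m_H`, `m_G`: let `γ_H ∈ H_v` be `G`-regular, near `1`, and `H_v`-conjugate to a LEVI element `γ₁ = yγ_Hy⁻¹` with `γ₁.1 = diag(d′₀, d′₁)` (so `ι_v(γ₁) = t =
diag(d′₀, u, d′₁) ∈ T` is regular and — near `1` — DEEP).  For a Borel `Ad K′`-invariant `g` on `U(H′)(L⁺_v)` whose canonical orbital integral at the matching class
`⟦ψ⁻¹t⟧` is `ν_G(K′)·J₃(t)·X` (through any level-preserving frame `ψ`):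
`Σᶠ_c Δ‴_v(γ_H, c)·Φ(c, g) = Δ‴(γ₁, ψ⁻¹t)·Φ(⟦ψ⁻¹t⟧, g)` (ONE matching class on the Levi stratum ★; `Δ‴` is a stable class function ★) `= ‖d′₀⁻¹u − 1‖·ν_G(K′)·J₃(t)·X`
(T5-Levi ★) `= ν_G(K′)·q^N·X` where `q^{−N} = |d′₀ − d′₁|_w`, `N ≥ 1` (skew modulus ★ `skewModulus_eq_inv_pow_of_valued_eq`), while `Φ^st(γ_H, χ₀) =
ν_H(K_H)·q^{N−1}` and `Φ^st(γ_H, χ₁) = ν_H(K_H)·(q^N − q^{N−1})` (Levi values ★ `DepthZeroTransferHValuesLeviPow`, over (δ) ★ p846606); hence **`Σᶠ_c Δ‴_v(γ_H, c)·Φ(c, g) = a₀·Φ^st(γ_H, χ₀) + a₁·Φ^st(γ_H, χ₁)` for ANY `a₀, a₁` with `a₀ + (q − 1)a₁ = (ν_G(K′)∕ν_H(K_H))·q·X`**.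
The depth needed by the `G`-side value is a PARAMETER `deep` (1-deep for a level-1 piece, 2-deep for a level-2 piece), required to hold on the Levi eigenvalues near `1`.

## References
* [Rogawski1990] J. D. Rogawski, *Automorphic Representations of Unitary Groups in Three Variables*, Ann. of Math. Stud. 123 (1990), §4.9 Prop. 4.9.1 (a)(b), (4.9.2) pp. 54–56;
  §4.3 (4.3.1) p. 43; §4.1 (4.1.1) p. 40.
* [LanglandsShelstad1987] R. P. Langlands, D. Shelstad, *On the definition of transfer factors*, Math. Ann. 278 (1987), §1.3–1.4.
* [Kottwitz1986] R. E. Kottwitz, *Base change for unit elements of Hecke algebras*, Compositio Math. 60 (1986), §3, §7.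
-/

set_option autoImplicit false

noncomputable section

open NumberField IsDedekindDomain MeasureTheory Measure Topology Filter Matrix
open Literature.NumberTheory.Automorphic Literature.NumberTheory.Automorphic.UnitaryGroup Literature.NumberTheory.Automorphic.IntegralReduction
open Literature.NumberTheory.GaloisRepresentations
open scoped Matrix MatrixGroups NNReal ENNReal ValuativeRel

namespace Literature.NumberTheory.Rogawski1990

/-- The scalar identity closing the Levi row: `‖a−1‖·ν_G·(‖a−1‖⁻¹·q^N)·X = a₀·ν_H·q^{N−1} + a₁·ν_H·(q^N − q^{N−1})` when
`(a₀ + (q−1)a₁)·ν_H = ν_G·q·X`. [cite: Rogawski1990, §4.9 Prop. 4.9.1 (b) p. 55] -/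
private theorem levi_row_scalar_identity {u r s q X a₀ a₁ : ℂ} (hu : u ≠ 0) (hq : q ≠ 0) {N : ℕ} (hN : 1 ≤ N)
    (ha : (a₀ + (q - 1) * a₁) * s = r * q * X) :
    u * (r * (u⁻¹ * (q⁻¹ ^ N)⁻¹) * X) = a₀ * (s * q ^ (N - 1)) + a₁ * (s * (q ^ N - q ^ (N - 1))) := by
  obtain ⟨M, rfl⟩ : ∃ M, N = M + 1 := ⟨N - 1, by omega⟩
  rw [Nat.add_sub_cancel, inv_pow, inv_inv, pow_succ]
  have e1 : u * (r * (u⁻¹ * (q ^ M * q)) * X) = (r * q * X) * q ^ M := by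
    field_simp
  rw [e1, ← ha]
  ring

set_option maxHeartbeats 1600000 in
-- instance-term unification on the CM local carriers (as in ★ FILE D ∕ ★ p846544)
open scoped Classical in
/-- **THE LEVI ROW OF T3′ AS A SOCKET IN THE `G`-SIDE VALUE** (organ (O5-core), architect A-149 (1)).  Frame of `stub_T3prime_levi`; `g` Borel and
`Ad K′`-invariant; `deep` a predicate on the three Levi eigenvalues holding on a neighbourhood of `1` (`hV`, a class-function condition read on `ι_v(yγ_Hy⁻¹) = diag d`)
and implying 1-deepness (`hdeep1`); `hX`: through every level-preserving Jacobowitz frame `ψ` (with its `T ∈ GL₃(𝒪_w)`), at every regular `deep` split-torus `t`,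
`Φ(⟦ψ⁻¹t⟧, g) = ν_G(K′)·J₃(t)·X` (★ p846544's socket conclusion VERBATIM); `ha : a₀ + (q−1)a₁ = (ν_G(K′)∕ν_H(K_H))·q·X`.  THEN the Levi row holds near `1` with
coefficients `a₀, a₁` against `χ₀, χ₁` (HEAD v4's indicator texts VERBATIM). [cite: Rogawski1990, §4.9 Prop. 4.9.1 (a)(b) pp. 54–56; §4.3 (4.3.1) p. 43; §4.1 (4.1.1) p. 40]
[cite: LanglandsShelstad1987, §1.3–1.4] -/
theorem finsum_delta_mul_classOrbitalIntegral_eq_of_levi_of_orbital_eq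
    (L : Type) [Field L] [NumberField L] [IsCMField L] (H' : Matrix (Fin 3) (Fin 3) L) (μ : HeckeCharacter L)
    {v : HeightOneSpectrum (𝓞 ↥(maximalRealSubfield L))}
    (hH' : (H'.map (cmConjRingHom L)).transpose = H') (w : PlacesOver L v)
    (hw : IsCMField.complexConj L • w.1 = w.1) (hv : Algebra.IsUnramifiedIn (𝓞 L) v.asIdeal)
    (hH'w : IsUnit (placeForm H' w.1)) (hH'i : hH'w.unit ∈ glInt 3 (w.1.adicCompletion L))
    (hμ : μ.IsUnramifiedAt w.1)
    (hμω : ∀ x : ideleGroup ↥(maximalRealSubfield L), μ (AdeleRing.ideleBaseChange ↥(maximalRealSubfield L) L x) = quadraticHeckeCharCM L x)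
    [MeasurableSpace ((cmDatum L 3 H').Local v)] [BorelSpace ((cmDatum L 3 H').Local v)]
    [∀ γ : ((cmDatum L 3 H').Local v), MeasurableSpace (((cmDatum L 3 H').Local v) ⧸ Subgroup.centralizer ({γ} : Set ((cmDatum L 3 H').Local v)))]
    [∀ γ : ((cmDatum L 3 H').Local v), BorelSpace (((cmDatum L 3 H').Local v) ⧸ Subgroup.centralizer ({γ} : Set ((cmDatum L 3 H').Local v)))]
    [MeasurableSpace ((cmDatum L 2 (Matrix.of fun i j : Fin 2 => if i.val + j.val + 1 = 2 then (1 : L) else 0)).Local v ×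
      (cmDatum L 1 (Matrix.of fun i j : Fin 1 => if i.val + j.val + 1 = 1 then (1 : L) else 0)).Local v)]
    [BorelSpace ((cmDatum L 2 (Matrix.of fun i j : Fin 2 => if i.val + j.val + 1 = 2 then (1 : L) else 0)).Local v ×
      (cmDatum L 1 (Matrix.of fun i j : Fin 1 => if i.val + j.val + 1 = 1 then (1 : L) else 0)).Local v)]
    [∀ a : ((cmDatum L 2 (Matrix.of fun i j : Fin 2 => if i.val + j.val + 1 = 2 then (1 : L) else 0)).Local v ×
      (cmDatum L 1 (Matrix.of fun i j : Fin 1 => if i.val + j.val + 1 = 1 then (1 : L) else 0)).Local v),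
      MeasurableSpace (((cmDatum L 2 (Matrix.of fun i j : Fin 2 => if i.val + j.val + 1 = 2 then (1 : L) else 0)).Local v ×
      (cmDatum L 1 (Matrix.of fun i j : Fin 1 => if i.val + j.val + 1 = 1 then (1 : L) else 0)).Local v) ⧸ Subgroup.centralizer ({a} : Set ((cmDatum L 2 (Matrix.of fun i j : Fin 2 => if i.val + j.val + 1 = 2 then (1 : L) else 0)).Local v ×
      (cmDatum L 1 (Matrix.of fun i j : Fin 1 => if i.val + j.val + 1 = 1 then (1 : L) else 0)).Local v)))]
    [∀ a : ((cmDatum L 2 (Matrix.of fun i j : Fin 2 => if i.val + j.val + 1 = 2 then (1 : L) else 0)).Local v ×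
      (cmDatum L 1 (Matrix.of fun i j : Fin 1 => if i.val + j.val + 1 = 1 then (1 : L) else 0)).Local v),
      BorelSpace (((cmDatum L 2 (Matrix.of fun i j : Fin 2 => if i.val + j.val + 1 = 2 then (1 : L) else 0)).Local v ×
      (cmDatum L 1 (Matrix.of fun i j : Fin 1 => if i.val + j.val + 1 = 1 then (1 : L) else 0)).Local v) ⧸ Subgroup.centralizer ({a} : Set ((cmDatum L 2 (Matrix.of fun i j : Fin 2 => if i.val + j.val + 1 = 2 then (1 : L) else 0)).Local v ×
      (cmDatum L 1 (Matrix.of fun i j : Fin 1 => if i.val + j.val + 1 = 1 then (1 : L) else 0)).Local v)))]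
    (νH : Measure ((cmDatum L 2 (Matrix.of fun i j : Fin 2 => if i.val + j.val + 1 = 2 then (1 : L) else 0)).Local v ×
      (cmDatum L 1 (Matrix.of fun i j : Fin 1 => if i.val + j.val + 1 = 1 then (1 : L) else 0)).Local v)) [νH.IsHaarMeasure] [νH.IsMulRightInvariant]
    (νG : Measure ((cmDatum L 3 H').Local v)) [νG.IsHaarMeasure] [νG.IsMulRightInvariant]
    {mH : OrbitalMeasureFamily ((cmDatum L 2 (Matrix.of fun i j : Fin 2 => if i.val + j.val + 1 = 2 then (1 : L) else 0)).Local v ×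
      (cmDatum L 1 (Matrix.of fun i j : Fin 1 => if i.val + j.val + 1 = 1 then (1 : L) else 0)).Local v)} {mG : OrbitalMeasureFamily ((cmDatum L 3 H').Local v)}
    (hmH : mH.IsCanonical (IsLocalGRegular L v) νH)
    (_hmG : mG.IsCanonical (fun γ => IsRegularElt (γ.val : GL (Fin 3) (UnitaryGroup.LocalRing L v))) νG)
    -- the piece: Borel and `Ad K′`-invariant (idle here; kept so the binder list is the `stub_T3prime_levi` frame verbatim for the corollaries)
    (g : ((cmDatum L 3 H').Local v) → ℂ) (_hgm : Measurable g)
    (_hginv : ∀ u ∈ cmLocalIntegralLevel L 3 H' v, ∀ x, g (u * x * u⁻¹) = g x)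
    -- the depth predicate on the Levi eigenvalues, holding near `1`, at least 1-deep
    (deep : (Fin 3 → (UnitaryGroup.LocalRing L v)ˣ) → Prop)
    (hV : ∃ V ∈ 𝓝 (1 : (cmDatum L 2 (Matrix.of fun i j : Fin 2 => if i.val + j.val + 1 = 2 then (1 : L) else 0)).Local v ×
        (cmDatum L 1 (Matrix.of fun i j : Fin 1 => if i.val + j.val + 1 = 1 then (1 : L) else 0)).Local v),
      ∀ γH ∈ V, ∀ (y : (cmDatum L 2 (Matrix.of fun i j : Fin 2 => if i.val + j.val + 1 = 2 then (1 : L) else 0)).Local v ×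
        (cmDatum L 1 (Matrix.of fun i j : Fin 1 => if i.val + j.val + 1 = 1 then (1 : L) else 0)).Local v) (d : Fin 3 → (UnitaryGroup.LocalRing L v)ˣ),
        ((endoEmbLocal L v (y * γH * y⁻¹)).val : GL (Fin 3) (UnitaryGroup.LocalRing L v)) = glDiagonal 3 (UnitaryGroup.LocalRing L v) d → deep d)
    (hdeep1 : ∀ d : Fin 3 → (UnitaryGroup.LocalRing L v)ˣ, deep d → ∀ i : Fin 3, Valued.v ((((d i : (UnitaryGroup.LocalRing L v)ˣ) : UnitaryGroup.LocalRing L v) w) - 1) < 1)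
    -- the `G`-side value at the deep regular split torus, through ANY level-preserving frame, and the coefficient test
    (X a₀ a₁ : ℂ)
    (hX : ∀ [MeasurableSpace ↥(unitaryGroupOfForm (conjLocal L (IsCMField.complexConj L) v) (cmLocalForm L 3 v))] [BorelSpace ↥(unitaryGroupOfForm (conjLocal L (IsCMField.complexConj L) v) (cmLocalForm L 3 v))]
      (ψ : (cmDatum L 3 H').Local v ≃ₜ* ↥(unitaryGroupOfForm (conjLocal L (IsCMField.complexConj L) v) (cmLocalForm L 3 v)))
      (_hψK : ∀ g : (cmDatum L 3 H').Local v, ψ g ∈ cmLocalIntegralLevel L 3 (Matrix.of fun i j : Fin 3 => if i.val + j.val + 1 = 3 then (1 : L) else 0) v ↔ g ∈ cmLocalIntegralLevel L 3 H' v)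
      (_hψc : ∀ g : (cmDatum L 3 H').Local v, IsConj (g.val : GL (Fin 3) (LocalRing L v)) ((ψ g : ↥(unitaryGroupOfForm (conjLocal L (IsCMField.complexConj L) v) (cmLocalForm L 3 v))) : GL (Fin 3) (LocalRing L v)))
      (T : GL (Fin 3) (w.1.adicCompletion L)) (_hT : T ∈ glInt 3 (w.1.adicCompletion L))
      (_hψT : ∀ g : (cmDatum L 3 H').Local v, localGLPiEquiv L 3 v (((ψ g : ↥(unitaryGroupOfForm (conjLocal L (IsCMField.complexConj L) v) (cmLocalForm L 3 v)))) : GL (Fin 3) (LocalRing L v)) w =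
        T * localGLPiEquiv L 3 v (g.val : GL (Fin 3) (LocalRing L v)) w * T⁻¹)
      (μN : Measure ↥(unipotentU (conjLocal L (IsCMField.complexConj L) v) (cmLocalForm L 3 v))) [μN.IsHaarMeasure]
      (t : ↥(torusU (conjLocal L (IsCMField.complexConj L) v) (cmLocalForm L 3 v))) (d : Fin 3 → (LocalRing L v)ˣ)
      (hd : glDiagonal 3 (LocalRing L v) d = ((t : ↥(unitaryGroupOfForm (conjLocal L (IsCMField.complexConj L) v) (cmLocalForm L 3 v))) : GL (Fin 3) (LocalRing L v)))
      (_hreg : ∀ i j, i ≠ j → IsUnit ((d i : LocalRing L v) - d j))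
      (ha' : IsUnit ((((d 0)⁻¹ * d 1 : (LocalRing L v)ˣ) : LocalRing L v) - 1)) (hb' : IsUnit ((((d 0)⁻¹ * d 2 : (LocalRing L v)ˣ) : LocalRing L v) - 1))
      (_hdp : deep d) (γ₀ : (cmDatum L 3 H').Local v) (_hγ₀ : ψ γ₀ = (t : ↥(unitaryGroupOfForm (conjLocal L (IsCMField.complexConj L) v) (cmLocalForm L 3 v)))),
      classOrbitalIntegral mG g (ConjClasses.mk γ₀) =
        (νG.real (cmLocalIntegralLevel L 3 H' v : Set ((cmDatum L 3 H').Local v)) : ℂ) * (((letI : MeasurableSpace (LocalRing L v) := borel _; haveI : BorelSpace (LocalRing L v) := ⟨rfl⟩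
          haveI : SecondCountableTopology (LocalRing L v) := secondCountableTopology_localRing (E := L) v
          ((distribHaarChar (LocalRing L v) ha'.unit)⁻¹ *
            (HeisRing.skewModulus (conjLocal L (IsCMField.complexConj L) v) (continuous_conjLocal L (IsCMField.complexConj L) v) hb'.unit
              (HeisRing.map_unit_torusCentralScalar_sub_one (conjLocal L (IsCMField.complexConj L) v) (cmLocalForm_eq_over L 3 v) t hd hb'))⁻¹ :
                ℝ≥0)) : ℝ≥0) : ℂ) * X)
    (ha : a₀ + ((Ideal.absNorm v.asIdeal : ℂ) - 1) * a₁ =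
      (νG.real (cmLocalIntegralLevel L 3 H' v : Set ((cmDatum L 3 H').Local v)) / νH.real (((cmLocalIntegralLevel L 2 (Matrix.of fun i j : Fin 2 => if i.val + j.val + 1 = 2 then (1 : L) else 0) v).prod
                (cmLocalIntegralLevel L 1 (Matrix.of fun i j : Fin 1 => if i.val + j.val + 1 = 1 then (1 : L) else 0) v) : Subgroup _) : Set _) : ℂ) *
        (Ideal.absNorm v.asIdeal : ℂ) * X) :
        ∃ V ∈ 𝓝 (1 : ((cmDatum L 2 (Matrix.of fun i j : Fin 2 => if i.val + j.val + 1 = 2 then (1 : L) else 0)).Local v ×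
        (cmDatum L 1 (Matrix.of fun i j : Fin 1 => if i.val + j.val + 1 = 1 then (1 : L) else 0)).Local v)),
      ∀ γH ∈ V, IsLocalGRegular L v γH →
        (∃ (y : ((cmDatum L 2 (Matrix.of fun i j : Fin 2 => if i.val + j.val + 1 = 2 then (1 : L) else 0)).Local v ×
        (cmDatum L 1 (Matrix.of fun i j : Fin 1 => if i.val + j.val + 1 = 1 then (1 : L) else 0)).Local v)) (d' : Fin 2 → (UnitaryGroup.LocalRing L v)ˣ),
          glDiagonal 2 (UnitaryGroup.LocalRing L v) d' = ((y * γH * y⁻¹).1.val : GL (Fin 2) (UnitaryGroup.LocalRing L v))) →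
        ∑ᶠ cG : ConjClasses ((cmDatum L 3 H').Local v),
            ((finExplicitCollection L H' μ (finExplicitDelta_conj_left_all L H' μ) (finExplicitDelta_conj_right_all L H' μ)) v).Δ γH (Quotient.out cG) *
              classOrbitalIntegral mG g cG =
          a₀ * stableOrbitalIntegralRel (IsLocalStablyConjH L v) mH
                ((((cmLocalIntegralLevel L 2 (Matrix.of fun i j : Fin 2 => if i.val + j.val + 1 = 2 then (1 : L) else 0) v).prod
                (cmLocalIntegralLevel L 1 (Matrix.of fun i j : Fin 1 => if i.val + j.val + 1 = 1 then (1 : L) else 0) v) : Subgroup _) : Set _).indicator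
              (fun h => if (redMat (((h.1.val : GL (Fin 2) (UnitaryGroup.LocalRing L v)).val.map (Pi.evalRingHom (fun w' : PlacesOver L v => w'.1.adicCompletion L) w))) - 1) ^ 2 = 0 ∧ (redMat (((h.1.val : GL (Fin 2) (UnitaryGroup.LocalRing L v)).val.map (Pi.evalRingHom (fun w' : PlacesOver L v => w'.1.adicCompletion L) w))) - 1).rank = 0 then (1 : ℂ) else 0)) γH +
          a₁ * stableOrbitalIntegralRel (IsLocalStablyConjH L v) mH
                ((((cmLocalIntegralLevel L 2 (Matrix.of fun i j : Fin 2 => if i.val + j.val + 1 = 2 then (1 : L) else 0) v).prod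
                (cmLocalIntegralLevel L 1 (Matrix.of fun i j : Fin 1 => if i.val + j.val + 1 = 1 then (1 : L) else 0) v) : Subgroup _) : Set _).indicator
              (fun h => if (redMat (((h.1.val : GL (Fin 2) (UnitaryGroup.LocalRing L v)).val.map (Pi.evalRingHom (fun w' : PlacesOver L v => w'.1.adicCompletion L) w))) - 1) ^ 2 = 0 ∧ (redMat (((h.1.val : GL (Fin 2) (UnitaryGroup.LocalRing L v)).val.map (Pi.evalRingHom (fun w' : PlacesOver L v => w'.1.adicCompletion L) w))) - 1).rank = 1 then (1 : ℂ) else 0)) γH := by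
  have hcne := IsCMField.complexConj_ne_one L
  haveI : Algebra.IsQuadraticExtension ↥(maximalRealSubfield L) L := IsCMField.isQuadraticExtension L
  have hH'σ : (H'.map (IsCMField.complexConj L))ᵀ = H' := hH'
  have hH'd : IsUnit H'.det := by
    have h := (Matrix.isUnit_iff_isUnit_det _).1 hH'w
    rw [show placeForm H' w.1 = (algebraMap L (w.1.adicCompletion L)).mapMatrix H' from rfl, ← RingHom.map_det] at h
    exact isUnit_iff_ne_zero.2 fun h0 => h.ne_zero (by rw [h0, map_zero])
  have hq0 : (Ideal.absNorm v.asIdeal : ℂ) ≠ 0 := by exact_mod_cast fun h => v.ne_bot (Ideal.absNorm_eq_zero_iff.1 h)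
  -- the frame `ψ`, `T`
  obtain ⟨ψ, T, hT, -, hψK, hψc, hψT⟩ := exists_continuousMulEquiv_level_formCongr_of_nonsplit L H' hH'σ w hw hv hH'w hH'i
  -- measurable structures on `U(Φ₃)(L⁺_v)` and a Haar measure on `N` (they only feed `hX`)
  haveI : LocallyCompactSpace ↥(unitaryGroupOfForm (conjLocal L (IsCMField.complexConj L) v) (cmLocalForm L 3 v)) := locallyCompactSpace_local (IsCMField.complexConj L) 3 _ v
  haveI : SecondCountableTopology ↥(unitaryGroupOfForm (conjLocal L (IsCMField.complexConj L) v) (cmLocalForm L 3 v)) := secondCountableTopology_local (IsCMField.complexConj L) 3 _ v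
  letI mU : MeasurableSpace ↥(unitaryGroupOfForm (conjLocal L (IsCMField.complexConj L) v) (cmLocalForm L 3 v)) := borel _
  haveI : BorelSpace ↥(unitaryGroupOfForm (conjLocal L (IsCMField.complexConj L) v) (cmLocalForm L 3 v)) := ⟨rfl⟩
  have hN₃ : IsClosed (((unipotentU (conjLocal L (IsCMField.complexConj L) v) (cmLocalForm L 3 v))) : Set ↥(unitaryGroupOfForm (conjLocal L (IsCMField.complexConj L) v) (cmLocalForm L 3 v))) := LineRing.isClosed_unipotentU _ _
  haveI : LocallyCompactSpace ↥(unipotentU (conjLocal L (IsCMField.complexConj L) v) (cmLocalForm L 3 v)) := hN₃.isClosedEmbedding_subtypeVal.locallyCompactSpace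
  obtain ⟨μN, hμN⟩ : ∃ μ : Measure ↥(unipotentU (conjLocal L (IsCMField.complexConj L) v) (cmLocalForm L 3 v)), μ = Measure.haar := ⟨_, rfl⟩
  haveI : μN.IsHaarMeasure := by rw [hμN]; infer_instance
  -- the neighbourhood
  obtain ⟨V, hV1, hVd⟩ := hV
  refine ⟨V, hV1, fun γH hγV hreg hlev => ?_⟩
  obtain ⟨y, d', hyd'⟩ := hlev
  -- the Levi representative `γ₁ = y γ_H y⁻¹`
  have hconj : IsConj γH (y * γH * y⁻¹) := isConj_iff.2 ⟨y, rfl⟩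
  have hHC := isLocalStablyConjH_of_isConj_and_conj L γH
  have hst : IsLocalStablyConjH L v γH (y * γH * y⁻¹) := hHC.1 _ hconj
  have hreg₁ : IsLocalGRegular L v (y * γH * y⁻¹) := (isLocalGRegular_conj_iff L y γH).2 hreg
  have hι := endoEmbLocal_eq_glDiagonal_of_fst_eq L v (y * γH * y⁻¹) hyd'
  have hu : (((isUnit_finGammaTwo L v (y * γH * y⁻¹)).unit : (UnitaryGroup.LocalRing L v)ˣ) : UnitaryGroup.LocalRing L v) = finGammaTwo L v (y * γH * y⁻¹) :=
    (isUnit_finGammaTwo L v (y * γH * y⁻¹)).unit_spec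
  obtain ⟨haU, hbU, h12⟩ := isUnit_levi_of_isLocalGRegular_of_nonsplit L w hw hyd' hreg₁
  have hreg3 := isUnit_vecCons_sub_of_levi haU hbU (by rw [hu]; exact h12)
  have hb3 : IsUnit ((((![d' 0, (isUnit_finGammaTwo L v (y * γH * y⁻¹)).unit, d' 1] 0)⁻¹ * ![d' 0, (isUnit_finGammaTwo L v (y * γH * y⁻¹)).unit, d' 1] 2 :
      (UnitaryGroup.LocalRing L v)ˣ) : UnitaryGroup.LocalRing L v) - 1) := hbU
  -- depth
  have hdp := hVd γH hγV y _ hι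
  have ht1 := hdeep1 _ hdp
  have ht1' : ∀ i : Fin 2, Valued.v ((((d' i : (UnitaryGroup.LocalRing L v)ˣ) : UnitaryGroup.LocalRing L v) w) - 1) < 1 := by
    intro i
    fin_cases i
    · exact ht1 0
    · exact ht1 2
  -- the torus element `t = ι_v(γ₁)` and the match `γ₀ = ψ⁻¹ t`
  have ht := endoEmbLocal_mem_torusU_of_endoEmbLocal_eq L v (y * γH * y⁻¹) hι
  obtain ⟨t, ht_eq⟩ : ∃ t : ↥(torusU (conjLocal L (IsCMField.complexConj L) v) (cmLocalForm L 3 v)), (t : ↥(unitaryGroupOfForm (conjLocal L (IsCMField.complexConj L) v) (cmLocalForm L 3 v))) = endoEmbLocal L v (y * γH * y⁻¹) := ⟨⟨_, ht⟩, rfl⟩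
  have hd : glDiagonal 3 (UnitaryGroup.LocalRing L v) ![d' 0, (isUnit_finGammaTwo L v (y * γH * y⁻¹)).unit, d' 1] = ((t : ↥(unitaryGroupOfForm (conjLocal L (IsCMField.complexConj L) v) (cmLocalForm L 3 v))) : GL (Fin 3) (UnitaryGroup.LocalRing L v)) := by
    rw [ht_eq]; exact hι.symm
  have htK : (t : ↥(unitaryGroupOfForm (conjLocal L (IsCMField.complexConj L) v) (cmLocalForm L 3 v))) ∈ cmLocalIntegralLevel L 3 (Matrix.of fun i j : Fin 3 => if i.val + j.val + 1 = 3 then (1 : L) else 0) v := torus_three_mem_cmLocalIntegralLevel_of_deep L w hw t hd ht1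
  have hint : endoEmbLocal L v (y * γH * y⁻¹) ∈ cmLocalIntegralLevel L 3 (Matrix.of fun i j : Fin 3 => if i.val + j.val + 1 = 3 then (1 : L) else 0) v := by rw [← ht_eq]; exact htK
  obtain ⟨γ₀, hγ₀⟩ : ∃ γ₀ : (cmDatum L 3 H').Local v, ψ γ₀ = (t : ↥(unitaryGroupOfForm (conjLocal L (IsCMField.complexConj L) v) (cmLocalForm L 3 v))) := ⟨ψ.symm _, ψ.apply_symm_apply _⟩
  have h₀ : IsLocalNormPair L H' v (y * γH * y⁻¹) γ₀ := by
    have h := hψc γ₀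
    rw [hγ₀, ht_eq] at h
    exact h.symm
  -- the `G` side: ONE term, `Δ‴ = ‖a − 1‖`, the socket value
  have hLHS := finsum_delta_mul_classOrbitalIntegral_eq_of_unique
    ((finExplicitCollection L H' μ (finExplicitDelta_conj_left_all L H' μ) (finExplicitDelta_conj_right_all L H' μ)) v) mG g (y * γH * y⁻¹) γ₀
    (fun k hk => isConj_of_isLocalNormPair_of_isLocalNormPair_of_levi L H' hH'σ hH'd (y * γH * y⁻¹) hι hreg3 h₀ hk)
  have hΔ : ((finExplicitCollection L H' μ (finExplicitDelta_conj_left_all L H' μ) (finExplicitDelta_conj_right_all L H' μ)) v).Δ (y * γH * y⁻¹) γ₀ =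
      (((unitModulusChar (UnitaryGroup.LocalRing L v) haU.unit : ℝ≥0) : ℝ) : ℂ) := by
    rw [finExplicitCollection_Δ]
    exact finExplicitDelta_eq_unitModulusChar_of_levi_of_nonsplit L H' hH'σ hH'd w hw hv hH'w hH'i μ hμ hμω (y * γH * y⁻¹) hι hreg3 hint haU h₀
  have hG := hX ψ hψK hψc T hT hψT μN t _ hd hreg3 haU hb3 hdp γ₀ hγ₀
  -- the `H` side: the LEVI values `Φ^st(γ_H, χ₀) = ν_H(K_H)·q^(N−1)`, `Φ^st(γ_H, χ₁) = ν_H(K_H)·(q^N − q^(N−1))` (★ `DepthZeroTransferHValuesLeviPow`)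
  have h01 : IsUnit (((d' 0 : (UnitaryGroup.LocalRing L v)ˣ) : UnitaryGroup.LocalRing L v) - d' 1) := by
    have key : ((d' 0 : (UnitaryGroup.LocalRing L v)ˣ) : UnitaryGroup.LocalRing L v) * ((((d' 0)⁻¹ * d' 1 : (UnitaryGroup.LocalRing L v)ˣ) : UnitaryGroup.LocalRing L v) - 1) =
        ((d' 1 : (UnitaryGroup.LocalRing L v)ˣ) : UnitaryGroup.LocalRing L v) - (d' 0 : (UnitaryGroup.LocalRing L v)ˣ) := by
      rw [mul_sub, mul_one, Units.val_mul, ← mul_assoc, Units.mul_inv, one_mul]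
    have h := (d' 0).isUnit.mul hbU
    rw [key, ← neg_sub] at h
    exact (IsUnit.neg_iff _).1 h
  have hNex : ∃ N : ℕ, Valued.v ((((d' 0 : (UnitaryGroup.LocalRing L v)ˣ) : UnitaryGroup.LocalRing L v) w) - (((d' 1 : (UnitaryGroup.LocalRing L v)ˣ) : UnitaryGroup.LocalRing L v) w)) = WithZero.exp (-(N : ℤ)) := by
    haveI : Algebra.IsQuadraticExtension ↥(maximalRealSubfield L) L := IsCMField.isQuadraticExtension L
    haveI : Subsingleton (PlacesOver L v) := PlacesOver.subsingleton_of_smul_eq (IsCMField.complexConj L) hcne w hw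
    -- a unit of `R = ∏ L_{w′}` is non-zero at `w`; integral of valuation `≤ 1`
    have hne : (((d' 0 : (UnitaryGroup.LocalRing L v)ˣ) : UnitaryGroup.LocalRing L v) w) - (((d' 1 : (UnitaryGroup.LocalRing L v)ˣ) : UnitaryGroup.LocalRing L v) w) ≠ 0 := by
      intro h0
      obtain ⟨e, he⟩ := h01
      have h1 : ((e : UnitaryGroup.LocalRing L v) * ((e⁻¹ : (UnitaryGroup.LocalRing L v)ˣ) : UnitaryGroup.LocalRing L v)) w = (1 : UnitaryGroup.LocalRing L v) w := by rw [e.mul_inv]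
      rw [Pi.mul_apply, he, Pi.sub_apply, h0, zero_mul, Pi.one_apply] at h1
      exact zero_ne_one h1
    have hle : Valued.v ((((d' 0 : (UnitaryGroup.LocalRing L v)ˣ) : UnitaryGroup.LocalRing L v) w) - (((d' 1 : (UnitaryGroup.LocalRing L v)ˣ) : UnitaryGroup.LocalRing L v) w)) ≤ 1 := by
      have e : (((d' 0 : (UnitaryGroup.LocalRing L v)ˣ) : UnitaryGroup.LocalRing L v) w) - (((d' 1 : (UnitaryGroup.LocalRing L v)ˣ) : UnitaryGroup.LocalRing L v) w) =
          ((((d' 0 : (UnitaryGroup.LocalRing L v)ˣ) : UnitaryGroup.LocalRing L v) w) - 1) - ((((d' 1 : (UnitaryGroup.LocalRing L v)ˣ) : UnitaryGroup.LocalRing L v) w) - 1) := by ring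
      rw [e]
      exact le_trans (Valuation.map_sub _ _ _) (max_le (ht1' 0).le (ht1' 1).le)
    have hv0 : Valued.v ((((d' 0 : (UnitaryGroup.LocalRing L v)ˣ) : UnitaryGroup.LocalRing L v) w) - (((d' 1 : (UnitaryGroup.LocalRing L v)ˣ) : UnitaryGroup.LocalRing L v) w)) ≠ 0 := (Valuation.ne_zero_iff _).2 hne
    rw [← WithZero.exp_log hv0] at hle ⊢
    rw [← WithZero.exp_zero, WithZero.exp_le_exp] at hle
    refine ⟨(-(WithZero.log (Valued.v ((((d' 0 : (UnitaryGroup.LocalRing L v)ˣ) : UnitaryGroup.LocalRing L v) w) - (((d' 1 : (UnitaryGroup.LocalRing L v)ˣ) : UnitaryGroup.LocalRing L v) w))))).toNat, ?_⟩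
    rw [WithZero.exp_inj]
    omega
  have hN := hNex.choose_spec
  have hN1 : 1 ≤ hNex.choose := one_le_depth_of_deep L v w ht1' hN
  -- `J₃(t)`: `χ⁻(d₀⁻¹d₂ − 1) = q^(−N)` and `‖a − 1‖ · ‖a − 1‖⁻¹ = 1`
  have hbv : ((hb3.unit : (UnitaryGroup.LocalRing L v)ˣ) : UnitaryGroup.LocalRing L v) = (((d' 0)⁻¹ * d' 1 : (UnitaryGroup.LocalRing L v)ˣ) : UnitaryGroup.LocalRing L v) - 1 := hb3.unit_spec
  have hsk := skewModulus_eq_inv_pow_of_valued_eq L v w hw hv hb3.unit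
    (HeisRing.map_unit_torusCentralScalar_sub_one (conjLocal L (IsCMField.complexConj L) v) (cmLocalForm_eq_over L 3 v) t hd hb3) hNex.choose
    (by rw [hbv, valued_torusScalar_sub_one_eq L v w (ht1' 0)]; exact hN)
  have hune : (unitModulusChar (UnitaryGroup.LocalRing L v) haU.unit : ℝ≥0) ≠ 0 := ((Group.isUnit haU.unit).map (unitModulusChar (UnitaryGroup.LocalRing L v))).ne_zero
  have hKHne : (νH.real (((cmLocalIntegralLevel L 2 (Matrix.of fun i j : Fin 2 => if i.val + j.val + 1 = 2 then (1 : L) else 0) v).prod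
                (cmLocalIntegralLevel L 1 (Matrix.of fun i j : Fin 1 => if i.val + j.val + 1 = 1 then (1 : L) else 0) v) : Subgroup _) : Set _) : ℂ) ≠ 0 := by
    have hK2 := isCompact_isOpen_cmLocalIntegralLevel L 2 (Matrix.of fun i j : Fin 2 => if i.val + j.val + 1 = 2 then (1 : L) else 0) v
    have hK1 := isCompact_isOpen_cmLocalIntegralLevel L 1 (Matrix.of fun i j : Fin 1 => if i.val + j.val + 1 = 1 then (1 : L) else 0) v
    rw [Complex.ofReal_ne_zero, measureReal_def, Subgroup.coe_prod]
    exact (ENNReal.toReal_pos ((hK2.2.prod hK1.2).measure_pos νH ⟨(1, 1), Subgroup.one_mem _, Subgroup.one_mem _⟩).ne'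
      (hK2.1.prod hK1.1).measure_lt_top.ne).ne'
  -- transport to `γ_H` (`Δ‴` is a stable class function) and close
  have hsum : (∑ᶠ cG : ConjClasses ((cmDatum L 3 H').Local v), ((finExplicitCollection L H' μ (finExplicitDelta_conj_left_all L H' μ) (finExplicitDelta_conj_right_all L H' μ)) v).Δ γH (Quotient.out cG) * classOrbitalIntegral mG g cG) =
      ∑ᶠ cG : ConjClasses ((cmDatum L 3 H').Local v), ((finExplicitCollection L H' μ (finExplicitDelta_conj_left_all L H' μ) (finExplicitDelta_conj_right_all L H' μ)) v).Δ (y * γH * y⁻¹) (Quotient.out cG) * classOrbitalIntegral mG g cG :=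
    finsum_congr fun cG => by
      rw [finExplicitCollection_Δ_eq_of_isLocalStablyConjH L v H' μ (finExplicitDelta_conj_left_all L H' μ) (finExplicitDelta_conj_right_all L H' μ) hst (Quotient.out cG)]
  have hune' : ((((unitModulusChar (UnitaryGroup.LocalRing L v) haU.unit : ℝ≥0)) : ℝ) : ℂ) ≠ 0 := by exact_mod_cast hune
  have ha' : (a₀ + ((Ideal.absNorm v.asIdeal : ℂ) - 1) * a₁) *
      (νH.real (((cmLocalIntegralLevel L 2 (Matrix.of fun i j : Fin 2 => if i.val + j.val + 1 = 2 then (1 : L) else 0) v).prod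
                (cmLocalIntegralLevel L 1 (Matrix.of fun i j : Fin 1 => if i.val + j.val + 1 = 1 then (1 : L) else 0) v) : Subgroup _) : Set _) : ℂ) =
      (νG.real (cmLocalIntegralLevel L 3 H' v : Set ((cmDatum L 3 H').Local v)) : ℂ) * (Ideal.absNorm v.asIdeal : ℂ) * X := by
    rw [ha]; field_simp
  -- assemble WITHOUT `rw` on the clause-sized goal (term-mode transitivity; the scalar identity on a small goal)
  refine hsum.trans (hLHS.trans ?_)
  -- the LEVI values (★ p07), with the decidability instances read off the goal
  refine Eq.trans ?_ (congrArg₂ (fun A B : ℂ => a₀ * A + a₁ * B)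
    (stableOrbitalIntegralRel_chiZero_eq_mul_pow_of_levi L v w hw νH hv hmH hreg y hyd' hNex.choose hN ht1' _)
    (stableOrbitalIntegralRel_chiOne_eq_mul_pow_sub_of_levi L v w hw νH hv hmH hreg y hyd' hNex.choose hN ht1' _)).symm
  refine Eq.trans (congrArg₂ (· * ·) hΔ hG) ?_
  -- the scalar identity, on a goal free of the clause's tokens
  have key : ∀ J : ℝ≥0, J = (unitModulusChar (UnitaryGroup.LocalRing L v) haU.unit)⁻¹ * ((((Ideal.absNorm v.asIdeal : ℝ≥0))⁻¹) ^ hNex.choose)⁻¹ →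
      ((((unitModulusChar (UnitaryGroup.LocalRing L v) haU.unit : ℝ≥0)) : ℝ) : ℂ) * ((νG.real (cmLocalIntegralLevel L 3 H' v : Set ((cmDatum L 3 H').Local v)) : ℂ) * (((J : ℝ≥0) : ℝ) : ℂ) * X) =
        a₀ * ((νH.real (((cmLocalIntegralLevel L 2 (Matrix.of fun i j : Fin 2 => if i.val + j.val + 1 = 2 then (1 : L) else 0) v).prod
                (cmLocalIntegralLevel L 1 (Matrix.of fun i j : Fin 1 => if i.val + j.val + 1 = 1 then (1 : L) else 0) v) : Subgroup _) : Set _) : ℂ) * (Ideal.absNorm v.asIdeal : ℂ) ^ (hNex.choose - 1)) + a₁ * ((νH.real (((cmLocalIntegralLevel L 2 (Matrix.of fun i j : Fin 2 => if i.val + j.val + 1 = 2 then (1 : L) else 0) v).prod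
                (cmLocalIntegralLevel L 1 (Matrix.of fun i j : Fin 1 => if i.val + j.val + 1 = 1 then (1 : L) else 0) v) : Subgroup _) : Set _) : ℂ) * ((Ideal.absNorm v.asIdeal : ℂ) ^ hNex.choose - (Ideal.absNorm v.asIdeal : ℂ) ^ (hNex.choose - 1))) := by
    intro J hJ
    subst hJ
    -- only the `ℝ≥0 → ℝ → ℂ` casts (no `push_cast`: it would also normalise the unit inside `IsUnit.unit`)
    simp only [NNReal.coe_mul, NNReal.coe_inv, NNReal.coe_pow, NNReal.coe_natCast, Complex.ofReal_mul,
      Complex.ofReal_inv, Complex.ofReal_pow, Complex.ofReal_natCast]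
    exact levi_row_scalar_identity hune' hq0 hN1 ha'
  refine key _ ?_
  rw [hsk]
  rfl

end Literature.NumberTheory.Rogawski1990

end
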